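import Summits.ResolutionOfSingularities.ResolutionOfSingularities.Theorems.EquisingularLiftEquisingularLiftNatSpecimenConeVertexChart
import HarnessLib

/-!
# [OURS · L1 W4.5(b)] ALL-n VERTEX CHART OF A CONE: the blow-up of the affine cone `V(G) ⊂ 𝔸ᴺ⁺¹` at its vertex has chart rings
# `k[T₀,…,T_N]/(G(T)|_{Tᵢ := 1})` (crux `Theses.EquisingularLift.EquisingularLiftNat`, stmt-ResolutionOfSingularities-20038 — item 3 of the all-n cone plan)

NOT a statement of any manuscript; OURS generic lemma (cell `res-hironaka`, chain w45b; seat res-D-pv-013, own initiative, counted 0). AI-written,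
weaker than expert review. No definition, no `sorry`, standard axioms.

The any-dimension port of `…SpecimenConeVertexChart` (p523254, `N = 2`): for `G ∈ A = k[y₀,…,y_N]` NON-ZERO HOMOGENEOUS of degree `d`,
`𝔪 = (y₀,…,y_N)` the vertex and `A[𝔪/yᵢ]` = tree `PointBlowup.Chart N k i`:

* `ConeN.isQuasiRegular_X`, `isDomain_quotient_origin`, `prime_exc` — the variables are a quasi-regular sequence, `A/𝔪 ≅ k`, and the exceptional
  equation `yᵢ ∈ A[𝔪/yᵢ]` is prime (the `Fin 3` versions are res-L1-w45b-stub-4's, …SpecimenQuarticPointStep);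
* `ConeN.exists_algEquiv_pointChart : k[T₀,…,T_N] ≃ₐ[k] A[𝔪/yᵢ]`, `Tᵢ ↦ yᵢ`, `T_j ↦ y_j/yᵢ`;
* `ConeN.algebraMap_eq_exc_pow_mul` (`G = yᵢ^d · G(y/yᵢ)`), `aeval_update_one_ne_zero`, `not_X_dvd_aeval_update_one`;
* **`ConeN.isRegularRing_vertexChart_of_isHomogeneous`** — if `k[T]/(G|_{Tᵢ := 1})` is regular then so is the `i`-th chart
  `(A/(G))[𝔪̄/ȳᵢ] ≅ A[𝔪/yᵢ]/(θ gᵢ)` of the blow-up of the cone at its vertex (GW 13.96 (2), `blowupAlgebra.quotientKerMapQuotientEquiv`).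

With `Cone.isRegularRing_quotient_aeval_update_one_of_isNonsingularForm` (p526332, any `n`) the hypothesis holds for every nonsingular form `G`.
References: Görtz–Wedhorn I Prop. 13.96 (2); The Stacks Project 0BIQ, 0804 — through the cited tree files.
-/

set_option linter.dupNamespace false -- mandated namespace `Summit.<Summit>.<Problem>` of this single-conjunct summit

noncomputable section

open MvPolynomial
open Literature.AlgebraicGeometry.Resolution
open Summit.ResolutionOfSingularities.ResolutionOfSingularities.Theorems.EquisingularLift.SpecimenQuartic

namespace Summit.ResolutionOfSingularities.ResolutionOfSingularities.Cruxes.EquisingularLiftNat.Sections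

namespace ConeN

variable (k : Type) [Field k] {N : ℕ}

/-! ## The vertex of `𝔸ᴺ⁺¹` as a blow-up centre -/

/-- The variables `(y₀, …, y_N)` form a quasi-regular sequence of `A = k[y₀,…,y_N]`. [folklore] -/
theorem isQuasiRegular_X : IsQuasiRegular (MvPolynomial.X : Fin (N + 1) → MvPolynomial (Fin (N + 1)) k) := by
  apply isQuasiRegular_of_isWeaklyRegular
  have h := MvPolynomial.isWeaklyRegular_map_X (R := k) (List.finRange (N + 1)) (List.nodup_finRange (N + 1))
  have hl : List.ofFn (MvPolynomial.X : Fin (N + 1) → MvPolynomial (Fin (N + 1)) k) =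
      (List.finRange (N + 1)).map (X : Fin (N + 1) → MvPolynomial (Fin (N + 1)) k) := by
    rw [List.ofFn_eq_map]
  rw [hl]
  exact h

/-- `A/(y₀, …, y_N) ≅ k` is a domain. [folklore] -/
theorem isDomain_quotient_origin : IsDomain (PointBlowup.R N k ⧸ PointBlowup.originIdeal N k) := by
  change IsDomain (MvPolynomial (Fin (N + 1)) k ⧸ Ideal.span (Set.range (X : Fin (N + 1) → MvPolynomial (Fin (N + 1)) k)))
  rw [← Set.image_univ]
  exact MvPolynomial.isDomain_quotient_span_X Set.univ

/-- The exceptional equation `yᵢ ∈ A[𝔪/yᵢ]` is a prime element (Stacks 0BIQ: `A[𝔪/yᵢ]/(yᵢ) ≅ k[T_j : j ≠ i]`). [cite: StacksProject, Tag 0BIQ] -/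
theorem prime_exc (i : Fin (N + 1)) : Prime (PointBlowup.exc N k i) := by
  haveI := isDomain_quotient_origin k (N := N)
  have hP : (Ideal.span {PointBlowup.exc N k i}).IsPrime :=
    blowupAlgebra.isPrime_span_algebraMap (MvPolynomial.X : Fin (N + 1) → MvPolynomial (Fin (N + 1)) k) i (isQuasiRegular_X k)
  haveI : Nontrivial (PointBlowup.Chart N k i) := (PointBlowup.polyEquiv N k i).injective.nontrivial
  have hne : PointBlowup.exc N k i ≠ 0 := nonZeroDivisors.ne_zero (PointBlowup.exc_mem_nonZeroDivisors N k i)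
  exact (Ideal.span_singleton_prime hne).mp hP

/-! ## The `k`-algebra chart isomorphism `k[T₀, …, T_N] ≅ A[𝔪/yᵢ]`, any `N` -/

/-- **`k[T₀, …, T_N] ≃ₐ[k] A[𝔪/yᵢ]`, `Tᵢ ↦ yᵢ`, `T_j ↦ y_j/yᵢ` (`j ≠ i`)** — the tree's `PointBlowup.polyEquiv` reindexed through
`Fin (N + 1) ≃ Unit ⊕ {j // j ≠ i}` (as in res-L1-w45b-stub-4's `exists_ringEquiv_pointChart`), upgraded to a `k`-algebra isomorphism. [folklore] -/
theorem exists_algEquiv_pointChart (i : Fin (N + 1)) :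
    ∃ θ : MvPolynomial (Fin (N + 1)) k ≃ₐ[k] PointBlowup.Chart N k i,
      θ (X i) = PointBlowup.exc N k i ∧ ∀ (j : Fin (N + 1)) (hj : j ≠ i), θ (X j) = PointBlowup.frac N k i j := by
  let e : Fin (N + 1) ≃ Unit ⊕ {j : Fin (N + 1) // j ≠ i} :=
    ((Equiv.optionSubtypeNe i).symm.trans (Equiv.optionEquivSumPUnit {j : Fin (N + 1) // j ≠ i})).trans (Equiv.sumComm _ _)
  have hei : e i = Sum.inl () := by simp [e]
  have hej : ∀ (j : Fin (N + 1)) (hj : j ≠ i), e j = Sum.inr ⟨j, hj⟩ := by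
    intro j hj
    simp [e, Equiv.optionSubtypeNe_symm_of_ne hj]
  have hC : ∀ c : k, PointBlowup.polyEquiv N k i (algebraMap k (MvPolynomial Unit (PointBlowup.Base N k i)) c) =
      algebraMap k (PointBlowup.Chart N k i) c := by
    intro c
    rw [IsScalarTower.algebraMap_apply k (PointBlowup.Base N k i) (MvPolynomial Unit (PointBlowup.Base N k i)),
      MvPolynomial.algebraMap_eq, MvPolynomial.algebraMap_eq, PointBlowup.polyEquiv_apply, PointBlowup.polyHom_C,
      PointBlowup.baseHom_C]
  let ρ : MvPolynomial Unit (PointBlowup.Base N k i) ≃ₐ[k] PointBlowup.Chart N k i :=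
    AlgEquiv.ofRingEquiv (f := PointBlowup.polyEquiv N k i) hC
  refine ⟨((renameEquiv k e).trans (sumAlgEquiv k Unit {j : Fin (N + 1) // j ≠ i})).trans ρ, ?_, ?_⟩
  · simp [ρ, hei]
  · intro j hj
    simp [ρ, hej j hj]

/-! ## The strict transform of the cone on the chart `A[𝔪/yᵢ]` -/

section Chart

variable (G : MvPolynomial (Fin (N + 1)) k) (i : Fin (N + 1))

/-- The chart map `k[y] → A[𝔪/yᵢ]` is evaluation at `(yᵢ · (y_j/yᵢ))_j` (with `yᵢ/yᵢ = 1`). [folklore] -/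
theorem algebraMap_eq_aeval_exc_mul_frac :
    algebraMap (MvPolynomial (Fin (N + 1)) k) (PointBlowup.Chart N k i) G =
      aeval (fun j => PointBlowup.exc N k i * PointBlowup.frac N k i j) G := by
  have h := congrArg (fun φ : MvPolynomial (Fin (N + 1)) k →ₐ[k] PointBlowup.Chart N k i => φ G)
    (MvPolynomial.algHom_ext (A := PointBlowup.Chart N k i)
      (f := IsScalarTower.toAlgHom k (MvPolynomial (Fin (N + 1)) k) (PointBlowup.Chart N k i))
      (g := aeval fun j => PointBlowup.exc N k i * PointBlowup.frac N k i j) fun j => by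
        rw [IsScalarTower.toAlgHom_apply, aeval_X]
        exact PointBlowup.algebraMap_X N k i j)
  simpa using h

variable {d : ℕ} (hG : G.IsHomogeneous d)

include hG in
/-- **`G = yᵢ^d · G(y/yᵢ)` in `A[𝔪/yᵢ]`** for `G` homogeneous of degree `d`. [folklore] -/
theorem algebraMap_eq_exc_pow_mul :
    algebraMap (MvPolynomial (Fin (N + 1)) k) (PointBlowup.Chart N k i) G =
      PointBlowup.exc N k i ^ d * aeval (PointBlowup.frac N k i) G := by
  rw [algebraMap_eq_aeval_exc_mul_frac, Cone.aeval_smul_eq_pow_mul_aeval hG]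

/-- Dehomogenising at `Tᵢ` and then setting `Tᵢ := 0` changes nothing (the result does not involve `Tᵢ`). [folklore] -/
theorem aeval_update_zero_aeval_update_one :
    aeval (Function.update (X : Fin (N + 1) → MvPolynomial (Fin (N + 1)) k) i 0)
        (aeval (Function.update (X : Fin (N + 1) → MvPolynomial (Fin (N + 1)) k) i 1) G) =
      aeval (Function.update (X : Fin (N + 1) → MvPolynomial (Fin (N + 1)) k) i 1) G := by
  rw [← AlgHom.comp_apply, comp_aeval]
  have hv : (fun j => aeval (Function.update (X : Fin (N + 1) → MvPolynomial (Fin (N + 1)) k) i 0)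
      (Function.update (X : Fin (N + 1) → MvPolynomial (Fin (N + 1)) k) i 1 j)) =
      Function.update (X : Fin (N + 1) → MvPolynomial (Fin (N + 1)) k) i 1 := by
    funext j
    by_cases hj : j = i
    · subst hj
      simp
    · simp [Function.update_of_ne hj]
  rw [hv]

/-- Under the chart isomorphism `θ`, the dehomogenised form `gᵢ = G(T)|_{Tᵢ := 1}` goes to `G(y/yᵢ)`. [folklore] -/
theorem algEquiv_aeval_update_one (θ : MvPolynomial (Fin (N + 1)) k ≃ₐ[k] PointBlowup.Chart N k i)
    (hθj : ∀ (j : Fin (N + 1)) (hj : j ≠ i), θ (X j) = PointBlowup.frac N k i j) :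
    θ (aeval (Function.update (X : Fin (N + 1) → MvPolynomial (Fin (N + 1)) k) i 1) G) = aeval (PointBlowup.frac N k i) G := by
  have h := MvPolynomial.algHom_ext (A := PointBlowup.Chart N k i)
    (f := (θ : MvPolynomial (Fin (N + 1)) k →ₐ[k] PointBlowup.Chart N k i).comp
      (aeval (Function.update (X : Fin (N + 1) → MvPolynomial (Fin (N + 1)) k) i 1)))
    (g := aeval (PointBlowup.frac N k i)) fun j => by
      rw [AlgHom.comp_apply, aeval_X, aeval_X]
      by_cases hj : j = i
      · subst hj
        rw [Function.update_self, map_one, PointBlowup.frac_self]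
      · rw [Function.update_of_ne hj]
        exact hθj j hj
  exact DFunLike.congr_fun h G

include hG in
/-- **Dehomogenising a NON-ZERO form gives a non-zero polynomial**: `gᵢ ≠ 0` for `G ≠ 0` homogeneous (`k[y] → A[𝔪/yᵢ]` is injective and
there `G = yᵢ^d · θ(gᵢ)`). [folklore] -/
theorem aeval_update_one_ne_zero (hG0 : G ≠ 0) :
    aeval (Function.update (X : Fin (N + 1) → MvPolynomial (Fin (N + 1)) k) i 1) G ≠ 0 := by
  obtain ⟨θ, -, hθj⟩ := exists_algEquiv_pointChart k i
  intro h0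
  have h1 : aeval (PointBlowup.frac N k i) G = 0 := by
    rw [← algEquiv_aeval_update_one k G i θ hθj, h0, map_zero]
  have h2 : algebraMap (MvPolynomial (Fin (N + 1)) k) (PointBlowup.Chart N k i) G = 0 := by
    rw [algebraMap_eq_exc_pow_mul k G i hG, h1, mul_zero]
  -- `k[y] → A[𝔪/yᵢ] ⊆ k[y][1/yᵢ]` is injective
  have h3 : algebraMap (MvPolynomial (Fin (N + 1)) k) (Localization.Away (X i : MvPolynomial (Fin (N + 1)) k)) G = 0 := by
    have h := congrArg (Subalgebra.val (blowupAlgebra (PointBlowup.originIdeal N k) (X i : MvPolynomial (Fin (N + 1)) k))) h2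
    rw [map_zero] at h
    exact h
  exact hG0 ((IsLocalization.injective (Localization.Away (X i : MvPolynomial (Fin (N + 1)) k))
    (powers_le_nonZeroDivisors_of_noZeroDivisors (X_ne_zero i))) (by rw [h3, map_zero]))

include hG in
/-- `Tᵢ ∤ gᵢ` (for `G ≠ 0`): `gᵢ` does not involve `Tᵢ`, and is non-zero. [folklore] -/
theorem not_X_dvd_aeval_update_one (hG0 : G ≠ 0) :
    ¬ (X i : MvPolynomial (Fin (N + 1)) k) ∣ aeval (Function.update (X : Fin (N + 1) → MvPolynomial (Fin (N + 1)) k) i 1) G := by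
  rintro ⟨h, hh⟩
  apply aeval_update_one_ne_zero k G i hG hG0
  rw [← aeval_update_zero_aeval_update_one k G i, hh, map_mul, aeval_X, Function.update_self, zero_mul]

include hG in
/-- **GENERIC VERTEX CHART OF A CONE.** For `G ∈ k[y₀,…,y_N]` non-zero homogeneous of degree `d` and `gᵢ = G(T)|_{Tᵢ := 1}`: if
`k[T₀,…,T_N]/(gᵢ)` is a regular ring then so is the `i`-th chart `(A/(G))[𝔪̄/ȳᵢ]` of the blow-up of the cone `V(G)` at its vertex
(`≅ A[𝔪/yᵢ]/(θ gᵢ)`, GW 13.96 (2)). [folklore; GW 13.96 (2)] -/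
theorem isRegularRing_vertexChart_of_isHomogeneous (hG0 : G ≠ 0)
    (hreg : IsRegularRing (MvPolynomial (Fin (N + 1)) k ⧸
      Ideal.span {aeval (Function.update (X : Fin (N + 1) → MvPolynomial (Fin (N + 1)) k) i 1) G})) :
    IsRegularRing (blowupAlgebra ((PointBlowup.originIdeal N k).map (Ideal.Quotient.mk (Ideal.span {G})))
      (Ideal.Quotient.mk (Ideal.span {G}) (X i))) := by
  obtain ⟨θ, hθi, hθj⟩ := exists_algEquiv_pointChart k i
  have hθg := algEquiv_aeval_update_one k G i θ hθj
  -- `G = yᵢ^d · θ(gᵢ)` in `A[𝔪/yᵢ]`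
  have hf : algebraMap (MvPolynomial (Fin (N + 1)) k) (PointBlowup.Chart N k i) G =
      algebraMap (MvPolynomial (Fin (N + 1)) k) (PointBlowup.Chart N k i) (X i) ^ d *
        θ (aeval (Function.update (X : Fin (N + 1) → MvPolynomial (Fin (N + 1)) k) i 1) G) := by
    rw [hθg]
    exact algebraMap_eq_exc_pow_mul k G i hG
  -- `yᵢ ∤ θ(gᵢ)`
  have hndvd : ¬ algebraMap (MvPolynomial (Fin (N + 1)) k) (PointBlowup.Chart N k i) (X i) ∣
      θ (aeval (Function.update (X : Fin (N + 1) → MvPolynomial (Fin (N + 1)) k) i 1) G) := by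
    intro h
    apply not_X_dvd_aeval_update_one k G i hG hG0
    have h' : θ (X i) ∣ θ (aeval (Function.update (X : Fin (N + 1) → MvPolynomial (Fin (N + 1)) k) i 1) G) := by rwa [hθi]
    exact (map_dvd_iff (θ : MvPolynomial (Fin (N + 1)) k ≃* PointBlowup.Chart N k i)).mp h'
  -- `k[T]/(gᵢ) ≅ A[𝔪/yᵢ]/(θ gᵢ)`
  have hmap : Ideal.map θ (Ideal.span {aeval (Function.update (X : Fin (N + 1) → MvPolynomial (Fin (N + 1)) k) i 1) G}) =
      Ideal.span {θ (aeval (Function.update (X : Fin (N + 1) → MvPolynomial (Fin (N + 1)) k) i 1) G)} := by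
    rw [Ideal.map_span, Set.image_singleton]
  haveI := hreg
  haveI : IsRegularRing (PointBlowup.Chart N k i ⧸
      Ideal.span {θ (aeval (Function.update (X : Fin (N + 1) → MvPolynomial (Fin (N + 1)) k) i 1) G)}) :=
    IsRegularRing.of_ringEquiv (Ideal.quotientEquiv _ _ θ.toRingEquiv (by
      rw [← hmap]; rfl))
  exact IsRegularRing.of_ringEquiv
    (R := PointBlowup.Chart N k i ⧸ Ideal.span {θ (aeval (Function.update (X : Fin (N + 1) → MvPolynomial (Fin (N + 1)) k) i 1) G)})
    (blowupAlgebra.quotientKerMapQuotientEquiv _ _ hf (prime_exc k i) hndvd)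

end Chart

end ConeN

end Summit.ResolutionOfSingularities.ResolutionOfSingularities.Cruxes.EquisingularLiftNat.Sections

end
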